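import Literature.AlgebraicGeometry.Motives.SeesawRelativeSubschemeReprIdeal
import HarnessLib

/-!
# RELATIVE EDITION (ring base `R`) — The seesaw closed subscheme, global half: the glued ideal sheaf and the universal property for every test scheme

RELATIVE EDITION of ★ `Motives/SeesawSubschemeGlobal` (port map `B-provers/B-p08/g11/PORTMAP-h8-RelativeSeesaw.B-p08g11.md`, file R9;
cell `hodgecm-mathlib`, F-DAG §5b hand (h8), author B-p08 (g11)): `SchemeOver ℂ ↦ SchemeOver R`, Stein as the hypothesis
`hSt : UnivStein X` (★ `SeesawRelativeChartSections`); DESIGN CHANGE for the relative edition: the affine-local representing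
ideals enter as a LOCAL hypothesis `hloc : ∀ U, ∃ J, IsReprIdeal X 𝓕 U J` on the given `(X, 𝓕)` (not the global statement
`N1cLocal` over all families), and the vestigial point `x₀` is dropped — so the head `exists_seesawSubscheme_of_sockets` can be fed by
an engine proved only for a sub-class of families (e.g. abelian schemes); namespace `Literature.AlgebraicGeometry.Motives.SeesawRelative`.
HC_CM is proved only modulo the 7 printed citations until rung 0 closes.  Original module docstring (with `ℂ` read as `R`):


[MumfordAV1970] §10 (p. 89) / [GortzWedhorn2023] Thm. 24.66, the GLOBAL half of the scheme-theoretic seesaw theorem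
for a rank-one quasi-coherent module `𝓕` on `X × W` (`X/ℂ` proper and geometrically integral with a point `x₀`, `W/ℂ`
locally of finite type), from the two named statements of `SeesawSubschemeReprIdeal`:
* §1 `reprIdealSheaf` — given `N1cLocal` (a representing ideal on every affine open), the affine-local representing
  ideals are compatible with basic opens by uniqueness, hence glue to a `Scheme.IdealSheafData` on `W` (no scheme gluing);
* §2 `seesawSubscheme` = its closed subscheme `Z(𝓕) ↪ W`; `factors_iff_le_ker` (Mathlib `IsClosedImmersion.lift`):
  `u : S → W` factors through `Z(𝓕)` iff the ideal sheaf dies under `u`; `le_ker_iff_trivFromBase`: for an ARBITRARY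
  test scheme `S/ℂ` this happens iff `(1 × u)^*𝓕` is trivialised from the base — cover `S` by affine opens mapping into
  affine opens of `W`, use the representing property there, and glue by `N1cDelta`;
* HEAD `exists_seesawSubscheme_of_sockets (hδ : N1cDelta) … : ∃ Z i, IsClosedImmersion i.left ∧
  ∀ S (u : S ⟶ W), (∃ v, v ≫ i = u) ↔ TrivFromBase`.
(Cell `hodgecm-mathlib`, M13 node N1, file S2 of the split plan; HOME certificate `B-plan/m13-glue/N1-Assembly.v9.B-p01g12.lean`
164baf9abb46c288, decls token-identical.)

## References
* [MumfordAV1970] D. Mumford, *Abelian Varieties* (1970), §10 p. 89.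
* [GortzWedhorn2023] U. Görtz, T. Wedhorn, *Algebraic Geometry II* (2023), Thm. 24.66 (p. 405; proof pp. 407–408).
-/

set_option autoImplicit false

noncomputable section

universe u

open CategoryTheory CategoryTheory.Limits AlgebraicGeometry MonoidalCategory CartesianMonoidalCategory

namespace Literature.AlgebraicGeometry.Motives

open SeesawRelative

/-! ## §1 The ideal sheaf glued from the affine-local representing ideals -/

namespace SeesawRelative

variable {R : Type} [CommRing R] (X : SchemeOver R) (W : SchemeOver R) [LocallyOfFiniteType W.hom]
  (𝓕 : (X ⊗ W).left.Modules)
  (hloc : ∀ U : W.left.affineOpens, ∃ J : Ideal Γ(W.left, U), IsReprIdeal X 𝓕 U J)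
include hloc

omit [LocallyOfFiniteType W.hom] in
/-- The representing ideal on an affine open, chosen from the local hypothesis `hloc` (non-Prop plumbing).
[cite: MumfordAV1970, §10 (p. 89)] -/
def reprIdeal (U : W.left.affineOpens) : Ideal Γ(W.left, U) :=
  (hloc U).choose

omit [LocallyOfFiniteType W.hom] in
/-- The chosen ideal represents. [cite: MumfordAV1970, §10 (p. 89)] -/
theorem isReprIdeal_reprIdeal (U : W.left.affineOpens) :
    SeesawRelative.IsReprIdeal X 𝓕 U (reprIdeal X W 𝓕 hloc U) :=
  (hloc U).choose_spec

/-- **The seesaw ideal sheaf** of `𝓕` on `W`: the affine-local representing ideals are compatible with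
basic opens by uniqueness, hence form an `IdealSheafData` (non-Prop plumbing).
[cite: MumfordAV1970, §10 (p. 89)] [cite: GortzWedhorn2023, Thm. 24.66 (p. 405; proof pp. 407–408)] -/
def reprIdealSheaf : W.left.IdealSheafData where
  ideal U := reprIdeal X W 𝓕 hloc U
  map_ideal_basicOpen U f :=
    ((isReprIdeal_reprIdeal X W 𝓕 hloc U).map_basicOpen X 𝓕 f).unique X 𝓕
      (isReprIdeal_reprIdeal X W 𝓕 hloc (W.left.affineBasicOpen f))

/-- The glued ideal sheaf has the chosen representing ideals as sections. [cite: MumfordAV1970, §10 (p. 89)] -/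
@[simp]
theorem reprIdealSheaf_ideal (U : W.left.affineOpens) :
    (SeesawRelative.reprIdealSheaf X W 𝓕 hloc).ideal U = reprIdeal X W 𝓕 hloc U := rfl

end SeesawRelative

/-! ## §2 The seesaw closed subscheme and its universal property -/

namespace SeesawRelative

variable {R : Type} [CommRing R] (X : SchemeOver R) (W : SchemeOver R) [LocallyOfFiniteType W.hom]
  (𝓕 : (X ⊗ W).left.Modules)
  (hloc : ∀ U : W.left.affineOpens, ∃ J : Ideal Γ(W.left, U), IsReprIdeal X 𝓕 U J)
include hloc

/-- **The seesaw subscheme** `Z(𝓕) ↪ W`: the closed subscheme of the glued representing ideal sheaf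
(non-Prop plumbing). [cite: MumfordAV1970, §10 (p. 89)] [cite: GortzWedhorn2023, Thm. 24.66 (p. 405; proof pp. 407–408)] -/
def seesawSubscheme : SchemeOver R :=
  Over.mk ((reprIdealSheaf X W 𝓕 hloc).subschemeι ≫ W.hom)

/-- The closed immersion `Z(𝓕) ↪ W` over `R` (non-Prop plumbing). [cite: MumfordAV1970, §10 (p. 89)] -/
def seesawSubschemeι : seesawSubscheme X W 𝓕 hloc ⟶ W :=
  Over.homMk (reprIdealSheaf X W 𝓕 hloc).subschemeι rfl

/-- Underlying closed immersion of `Z(𝓕) ↪ W`. [cite: MumfordAV1970, §10 (p. 89)] -/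
@[simp]
theorem seesawSubschemeι_left :
    (SeesawRelative.seesawSubschemeι X W 𝓕 hloc).left = (reprIdealSheaf X W 𝓕 hloc).subschemeι := rfl

/-- `Z(𝓕) ↪ W` is a closed immersion (instance on the file-local definition). [folklore] -/
instance : IsClosedImmersion (seesawSubschemeι X W 𝓕 hloc).left :=
  (inferInstance : IsClosedImmersion (reprIdealSheaf X W 𝓕 hloc).subschemeι)

/-- The kernel ideal sheaf of `Z(𝓕) ↪ W` is the seesaw ideal sheaf. [cite: MumfordAV1970, §10 (p. 89)] -/
theorem ker_seesawSubschemeι_left :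
    (SeesawRelative.seesawSubschemeι X W 𝓕 hloc).left.ker = reprIdealSheaf X W 𝓕 hloc :=
  (reprIdealSheaf X W 𝓕 hloc).ker_subschemeι

/-- **Factoring through `Z(𝓕)` ⟺ killing its ideal sheaf** (Mathlib `IsClosedImmersion.lift`). [cite: MumfordAV1970, §10 (p. 89)] -/
theorem factors_iff_le_ker {S : SchemeOver R} (u : S ⟶ W) :
    (∃ v : S ⟶ SeesawRelative.seesawSubscheme X W 𝓕 hloc, v ≫ seesawSubschemeι X W 𝓕 hloc = u) ↔
      reprIdealSheaf X W 𝓕 hloc ≤ u.left.ker := by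
  constructor
  · rintro ⟨v, hv⟩
    rw [← ker_seesawSubschemeι_left X W 𝓕 hloc, ← hv, Over.comp_left]
    exact Scheme.Hom.le_ker_comp _ _
  · intro hle
    have hle' : (seesawSubschemeι X W 𝓕 hloc).left.ker ≤ u.left.ker := by
      rwa [ker_seesawSubschemeι_left]
    refine ⟨Over.homMk (IsClosedImmersion.lift (seesawSubschemeι X W 𝓕 hloc).left u.left hle')
      ?_, ?_⟩
    · rw [← Over.w (seesawSubschemeι X W 𝓕 hloc), ← Category.assoc, IsClosedImmersion.lift_fac]
      exact Over.w u
    · ext : 1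
      exact IsClosedImmersion.lift_fac _ _ _

/-- **Killing the ideal sheaf ⟺ trivialised from the base**, for an ARBITRARY test scheme `S` over `R`
(sheaf locality on the test scheme + the affine-local representing property on the affine opens of `S` mapping
into affine opens of `W` + the locality statement `N1cDelta`).
[cite: MumfordAV1970, §10 (p. 89)] -/
theorem le_ker_iff_trivFromBase [GeometricallyIntegral X.hom] (hSt : SeesawRelative.UnivStein X) [𝓕.IsQuasicoherent]
    (h𝓕 : HasRank 𝓕 1) (hδ : N1cDelta) {S : SchemeOver R} (u : S ⟶ W) :
    reprIdealSheaf X W 𝓕 hloc ≤ u.left.ker ↔ TrivFromBase X 𝓕 u := by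
  have hrepr := isReprIdeal_reprIdeal X W 𝓕 hloc
  change reprIdealSheaf X W 𝓕 hloc ≤
    Scheme.IdealSheafData.ofIdeals (fun U => RingHom.ker (u.left.app U).hom) ↔ _
  rw [Scheme.IdealSheafData.le_ofIdeals_iff]
  constructor
  · -- `⇒`: locally on `S` the test morphism lands in an affine of `W`, where the ideal is killed
    intro hJ
    refine hδ X hSt W 𝓕 h𝓕 S u fun s => ?_
    obtain ⟨U', hU', hsU', -⟩ :=
      exists_isAffineOpen_mem_and_subset (show u.left.base s ∈ (⊤ : W.left.Opens) from trivial)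
    obtain ⟨V', hV', hsV', hV'U⟩ :=
      exists_isAffineOpen_mem_and_subset (show s ∈ u.left ⁻¹ᵁ U' from hsU')
    haveI : IsAffine (openTest V').left := hV'
    have htriv : TrivFromBase X 𝓕 (restrictTest V' u) :=
      (hrepr ⟨U', hU'⟩ (openTest V') (restrictTest V' u) (preimage_restrictTest_eq_top hV'U)).2
        ((hJ ⟨U', hU'⟩).trans (ker_app_le_ker_restrictTest_app V' u U'))
    exact ⟨V', hsV', htriv⟩
  · -- `⇐`: on every affine `V ⊆ u⁻¹U` the restricted test morphism is trivialised, so the ideal dies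
    --      there; by sheaf locality it dies in `Γ(S, u⁻¹U)`
    intro htriv U x hx
    refine app_eq_zero_of_forall_affineOpens u U x fun V hV => ?_
    haveI : IsAffine (openTest (V : S.left.Opens)).left := V.2
    exact (hrepr U (openTest (V : S.left.Opens)) (restrictTest (V : S.left.Opens) u)
      (preimage_restrictTest_eq_top hV)).1 (htriv.restrict X 𝓕 (V : S.left.Opens)) hx

/-- **N1, GLOBAL HALF — the universal property of the seesaw subscheme for every test scheme `S/ℂ`**,
from the LOCAL hypothesis `hloc` (affine-local representing ideals of `(X, 𝓕)`) and `N1cDelta` (locality of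
«trivialised from the base» on the test scheme). [cite: MumfordAV1970, §10 (p. 89)]
[cite: GortzWedhorn2023, Thm. 24.66 (p. 405; proof pp. 407–408)] -/
theorem seesawSubscheme_universal [GeometricallyIntegral X.hom] (hSt : SeesawRelative.UnivStein X) [𝓕.IsQuasicoherent]
    (h𝓕 : HasRank 𝓕 1) (hδ : N1cDelta) {S : SchemeOver R} (u : S ⟶ W) :
    (∃ v : S ⟶ seesawSubscheme X W 𝓕 hloc, v ≫ seesawSubschemeι X W 𝓕 hloc = u) ↔
      TrivFromBase X 𝓕 u :=
  (factors_iff_le_ker X W 𝓕 hloc u).trans (le_ker_iff_trivFromBase X W 𝓕 hloc hSt h𝓕 hδ u)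

end SeesawRelative

namespace SeesawRelative

/-- **N1 `stub_M13_1_seesawSubscheme` (B-p12 probe :191/:205, ALL test schemes `S/ℂ`),
FROM `hloc` (affine-local representing ideals) + `N1cDelta`** (relative edition: for a geometrically integral universally Stein `X → Spec R`; ★ text: for a proper geometrically integral `X/ℂ` with a rational
point, a locally-finite-type `W` and a rank-one quasi-coherent `𝓕` on `X × W`, there is a closed subscheme
`Z ↪ W` such that ANY `u : S → W` over `R` factors through `Z` iff `(1 × u)^*𝓕 ≅ pr_S^*𝓜` for an
invertible quasi-coherent `𝓜` on `S`. [cite: MumfordAV1970, §10 (p. 89)] [cite: GortzWedhorn2023, Thm. 24.66 (p. 405; proof pp. 407–408)] -/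
theorem exists_seesawSubscheme_of_sockets {R : Type} [CommRing R] (X : SchemeOver R) [GeometricallyIntegral X.hom]
    (hSt : SeesawRelative.UnivStein X) (W : SchemeOver R) [LocallyOfFiniteType W.hom] (𝓕 : (X ⊗ W).left.Modules) [𝓕.IsQuasicoherent]
    (h𝓕 : HasRank 𝓕 1) (hloc : ∀ U : W.left.affineOpens, ∃ J : Ideal Γ(W.left, U), IsReprIdeal X 𝓕 U J)
    (hδ : N1cDelta) :
    ∃ (Z : SchemeOver R) (i : Z ⟶ W) (_ : IsClosedImmersion i.left),
      ∀ (S : SchemeOver R) (u : S ⟶ W),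
        (∃ v : S ⟶ Z, v ≫ i = u) ↔
          ∃ (𝓜 : S.left.Modules) (_ : 𝓜.IsQuasicoherent) (_ : HasRank 𝓜 1),
            Nonempty ((Scheme.Modules.pullback (X ◁ u).left).obj 𝓕 ≅
              (Scheme.Modules.pullback (CartesianMonoidalCategory.snd X S).left).obj 𝓜) :=
  ⟨seesawSubscheme X W 𝓕 hloc, seesawSubschemeι X W 𝓕 hloc, inferInstance,
    fun _ u => seesawSubscheme_universal X W 𝓕 hloc hSt h𝓕 hδ u⟩

end SeesawRelative

end Literature.AlgebraicGeometry.Motives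

end
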